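import Summits.PneNP.PneNP.Theorems.CliqueExtLowerBound.Negative.DeltaMonotone
import Summits.PneNP.PneNP.Theorems.ConvexRankGatesConvexGateBlind

/-!
# PneNP / ConvexRankGates — glue algebra around `MixedBasisSynthesis` (stmt-PneNP-14728)

The support item `MixedBasisSynthesis : ConvexGateBlind → LinAlgGateBlind → CliqueExtLowerBound`
(route `ConvexRankGates`, rev 6) is the ALTERNATION RESIDUAL of crux #5 `CliqueExtLowerBound` over the
two single-door cruxes #2 `ConvexGateBlind` (basis `{∧₂,∨₂} ∪ CONV_s`) and #4 `LinAlgGateBlind`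
(basis `{∧₂,∨₂} ∪ PERM_s ∪ GRANK_s`). It is not provable stand-alone: the hypotheses give no handle on
circuits that INTERLEAVE CONV gates with PERM/GRANK gates. This `--supports` file records, sorry-free,
the part of the glue that IS formal bookkeeping, so that the residual is pinned down exactly:

* §1 `mixedBasisSynthesis_of_cliqueExtLowerBound` — discharge (a): a proof of #5 closes the glue item in
  one line; `linAlgGateBlind_of_cliqueExtLowerBound` — the converse edge #5 → #4 on the live (rev-2) decls
  (#5 → #2 is `convexGateBlind_of_cliqueExtLowerBound`); `mixedBasisSynthesis_iff_cliqueExtLowerBound_iff` —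
  the glue item is EXACTLY the statement that #5 is equivalent to #2 ∧ #4.
* §2 `doors_blind_common_delta` — the two hypotheses, each with its own exponent, hold at ONE common
  exponent `δ = max δ₂ δ₄ < 1/2` (monotonicity in `δ` by apex padding,
  `CliqueExtLowerBound.Negative.lowerBoundAtOver_rpow_mono`), so the "third delta" of the informal statement
  is never needed; `pureDoor_blind` — hence at that `δ`, for every `c`, eventually no circuit of size
  `≤ m^c` all of whose wide gates come from ONE door (which door may depend on the circuit) computes
  `CLIQUE(m, ⌈m^δ⌉₊)`. What remains of the item is precisely the interleaved circuits.
* §3 `mixedBasisSynthesis_of_commonDelta` — normal form of the residual in the Literature vocabulary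
  (`LowerBoundAtOver` / `LinLowerBoundAt` / `LowerBoundAt` at one `δ`); `mixedBasisSynthesis_of_doorSeparation`
  — the glue follows from any DOOR-SEPARATION theorem (every polynomial mixed circuit computing a clique
  function is matched by a polynomial single-door circuit for the same function); no such theorem is known,
  which is the honest content of the item ("no synergy between the convex door and the algebraic door").

Nothing here closes stmt-PneNP-14728; the item closes from a proof of stmt-PneNP-10682 (§1) or from an
engine theorem for #5 fed by single-gate properties (route text, TWO-LAYER PLAN).
-/

namespace Summit.PneNP.PneNP.Theorems

open Filter Literature.Computability.Complexity
open Summit.PneNP.PneNP.Theses.ConvexRankGates (CliqueExtLowerBound LinAlgGateBlind ConvexGateBlind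
  MixedBasisSynthesis)
open Summit.PneNP.PneNP.Theorems.CliqueExtLowerBound.Negative

/-! ## §1 The glue as an equivalence of cruxes -/

/-- **Discharge (a).** A proof of crux #5 `CliqueExtLowerBound` closes the glue item outright (the two
hypotheses are not used). [folklore] -/
theorem mixedBasisSynthesis_of_cliqueExtLowerBound (h : CliqueExtLowerBound) : MixedBasisSynthesis :=
  fun _ _ => h

/-- **Crux #5 implies crux #4** on the live decls: a circuit over the linear-algebra sub-basis
`{∧₂,∨₂} ∪ PERM_{m^c} ∪ GRANK_{m^c}` is a circuit over the full basis `B_{m^c}`, same `δ`, same `c`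
(`linLowerBoundAt_of_lowerBoundAt`). [folklore] -/
theorem linAlgGateBlind_of_cliqueExtLowerBound (h : CliqueExtLowerBound) : LinAlgGateBlind := by
  obtain ⟨δ, h0, h1, hlb⟩ := cliqueExtLowerBound_iff.1 h
  exact linAlgGateBlind_iff.2 ⟨δ, h0, h1, linLowerBoundAt_of_lowerBoundAt hlb⟩

/-- **The glue item is exactly the equivalence `#5 ↔ #2 ∧ #4`.** The edges #5 → #2, #5 → #4 are
unconditional (sub-bases), so `MixedBasisSynthesis` holds iff `CliqueExtLowerBound` is equivalent to the
conjunction of `ConvexGateBlind` and `LinAlgGateBlind`. [folklore] -/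
theorem mixedBasisSynthesis_iff_cliqueExtLowerBound_iff :
    MixedBasisSynthesis ↔ (CliqueExtLowerBound ↔ (ConvexGateBlind ∧ LinAlgGateBlind)) := by
  constructor
  · intro h
    exact ⟨fun h5 => ⟨convexGateBlind_of_cliqueExtLowerBound h5, linAlgGateBlind_of_cliqueExtLowerBound h5⟩,
      fun h24 => h h24.1 h24.2⟩
  · intro h h2 h4
    exact h.2 ⟨h2, h4⟩

/-! ## §2 One common exponent; pure-door circuits -/

/-- The arity-0 constant `true` is in the convex sub-basis at every level (a CONV gate of width 0).
[folklore] -/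
theorem constTrue_mem_convFamily (s : ℕ) :
    (⟨0, fun _ => true⟩ : GateFn) ∈ ({GateFn.and 2, GateFn.or 2} ∪ {g | IsConvGate s g} : Set GateFn) :=
  Or.inr ((isConvGate_constTrue 0).mono (Nat.zero_le s))

/-- The arity-0 constant `true` is in the linear-algebra sub-basis at every level (a GRANK gate of
dimension 0). [folklore] -/
theorem constTrue_mem_linFamily (s : ℕ) :
    (⟨0, fun _ => true⟩ : GateFn) ∈
      ({GateFn.and 2, GateFn.or 2} ∪ {g | IsPermGate s g ∨ IsGRankGate s g} : Set GateFn) :=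
  Or.inr (Or.inr ((isGRankGate_constTrue 0).mono (Nat.zero_le s)))

/-- **Both doors blind at ONE exponent.** From #2 (at its `δ₂`) and #4 (at its `δ₄`) both single-door
lower bounds hold at `δ = max δ₂ δ₄ ∈ (0, 1/2)`: hardness moves up in the exponent by apex padding
(`lowerBoundAtOver_rpow_mono`). So the informal proviso "each hypothesis carries its own delta; the
conclusion may pick a third" costs nothing. [folklore] -/
theorem doors_blind_common_delta (hC : ConvexGateBlind) (hL : LinAlgGateBlind) :
    ∃ δ : ℝ, 0 < δ ∧ δ < 1 / 2 ∧
      LowerBoundAtOver (fun s => {GateFn.and 2, GateFn.or 2} ∪ {g | IsConvGate s g})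
        (fun m => ⌈(m : ℝ) ^ δ⌉₊) ∧
      LinLowerBoundAt (fun m => ⌈(m : ℝ) ^ δ⌉₊) := by
  obtain ⟨δ₂, h20, h21, hC'⟩ := convexGateBlind_iff_over.1 hC
  obtain ⟨δ₄, h40, h41, hL'⟩ := linAlgGateBlind_iff.1 hL
  have hlt : max δ₂ δ₄ < 1 / 2 := max_lt h21 h41
  refine ⟨max δ₂ δ₄, lt_max_of_lt_left h20, hlt, ?_, ?_⟩
  · exact lowerBoundAtOver_rpow_mono convFamily_monotone constTrue_mem_convFamily h20 (le_max_left _ _)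
      (by linarith) hC'
  · exact lowerBoundAtOver_rpow_mono linFamily_monotone constTrue_mem_linFamily h40 (le_max_right _ _)
      (by linarith) hL'

/-- **Pure-door synthesis.** From #2 and #4: at a common `δ ∈ (0, 1/2)`, for every `c`, eventually in `m`,
no circuit with `≤ m^c` gates all of whose gates lie in ONE of the two sub-bases (`{∧₂,∨₂} ∪ CONV_{m^c}`
or `{∧₂,∨₂} ∪ PERM_{m^c} ∪ GRANK_{m^c}`; which one may depend on the circuit) computes `CLIQUE(m, ⌈m^δ⌉₊)`.
The circuits NOT covered — those using a CONV gate AND a PERM/GRANK gate — are the whole content of the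
glue item. [folklore] -/
theorem pureDoor_blind (hC : ConvexGateBlind) (hL : LinAlgGateBlind) :
    ∃ δ : ℝ, 0 < δ ∧ δ < 1 / 2 ∧ ∀ c : ℕ, ∀ᶠ m : ℕ in atTop,
      ∀ C : Circuit ((⊤ : SimpleGraph (Fin m)).edgeSet),
        (C.IsOver ({GateFn.and 2, GateFn.or 2} ∪ {g | IsConvGate (m ^ c) g}) ∨
          C.IsOver ({GateFn.and 2, GateFn.or 2} ∪ {g | IsPermGate (m ^ c) g ∨ IsGRankGate (m ^ c) g})) →
        C.size ≤ m ^ c → ¬ C.Computes (cliqueFn m ⌈(m : ℝ) ^ δ⌉₊) := by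
  obtain ⟨δ, h0, h1, hC', hL'⟩ := doors_blind_common_delta hC hL
  refine ⟨δ, h0, h1, fun c => ?_⟩
  filter_upwards [hC' c, hL' c] with m hmC hmL C hover hsize
  rcases hover with h | h
  · exact hmC C h hsize
  · exact hmL C h hsize

/-! ## §3 Normal forms of the residual -/

/-- **Common-exponent normal form.** To prove the glue item it suffices to prove, for each single
`δ ∈ (0, 1/2)`: CONV-door hardness at `⌈m^δ⌉₊` and PERM/GRANK-door hardness at `⌈m^δ⌉₊` imply full-basis
hardness at `⌈m^δ⌉₊` (all three in the schedule vocabulary of `CliqueExtLowerBound.Negative`). [folklore] -/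
theorem mixedBasisSynthesis_of_commonDelta
    (h : ∀ δ : ℝ, 0 < δ → δ < 1 / 2 →
      LowerBoundAtOver (fun s => {GateFn.and 2, GateFn.or 2} ∪ {g | IsConvGate s g})
        (fun m => ⌈(m : ℝ) ^ δ⌉₊) →
      LinLowerBoundAt (fun m => ⌈(m : ℝ) ^ δ⌉₊) → LowerBoundAt (fun m => ⌈(m : ℝ) ^ δ⌉₊)) :
    MixedBasisSynthesis := by
  intro hC hL
  obtain ⟨δ, h0, h1, hC', hL'⟩ := doors_blind_common_delta hC hL
  exact cliqueExtLowerBound_iff.2 ⟨δ, h0, h1, h δ h0 h1 hC' hL'⟩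

/-- **The glue follows from door separation.** If for every `c` there is a `c'` such that, eventually in
`m`, every `B_{m^c}`-circuit with `≤ m^c` gates computing some `CLIQUE(m, k)` is matched by a circuit with
`≤ m^{c'}` gates over ONE of the two sub-bases at level `m^{c'}` computing the same function, then
`MixedBasisSynthesis` holds (`pureDoor_blind`). No such separation theorem is known — a CONV gate reading
GRANK outputs has no decomposition theory — and this is exactly what a bare-hands proof of the item would
have to supply. [folklore] -/
theorem mixedBasisSynthesis_of_doorSeparation
    (hsep : ∀ c : ℕ, ∃ c' : ℕ, ∀ᶠ m : ℕ in atTop, ∀ k : ℕ,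
      ∀ C : Circuit ((⊤ : SimpleGraph (Fin m)).edgeSet),
        C.IsOver (extGate (m ^ c)) → C.size ≤ m ^ c → C.Computes (cliqueFn m k) →
        ∃ C' : Circuit ((⊤ : SimpleGraph (Fin m)).edgeSet),
          (C'.IsOver ({GateFn.and 2, GateFn.or 2} ∪ {g | IsConvGate (m ^ c') g}) ∨
            C'.IsOver ({GateFn.and 2, GateFn.or 2} ∪
              {g | IsPermGate (m ^ c') g ∨ IsGRankGate (m ^ c') g})) ∧
          C'.size ≤ m ^ c' ∧ C'.Computes (cliqueFn m k)) :
    MixedBasisSynthesis := by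
  intro hC hL
  obtain ⟨δ, h0, h1, hpure⟩ := pureDoor_blind hC hL
  refine cliqueExtLowerBound_iff.2 ⟨δ, h0, h1, fun c => ?_⟩
  obtain ⟨c', hc'⟩ := hsep c
  filter_upwards [hc', hpure c'] with m hm hp C hover hsize hcomp
  obtain ⟨C', hover', hsize', hcomp'⟩ := hm _ C hover hsize hcomp
  exact hp C' hover' hsize' hcomp'

end Summit.PneNP.PneNP.Theorems
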